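import Mathlib
import Summits.Ventures.PercRepro2.Graph
import Summits.Ventures.PercRepro2.CycleConn

/-!
# Necklaces: five mark-free two-terminal blocks in a cycle — connectivity between the marks
(blind cell PercRepro2, typer-1 g48)

The NECKLACE of LEAD-CYCLES.md §1: `C₅` with each arc replaced by a mark-free two-terminal block.
A necklace on `ends : E → Sym2 V` with marks `q : Fin 5 → V` is a partition of the edges into five
blocks `blk e`, block `j` living on a vertex set `Vj j ∋ q j, q (j + 1)`, two blocks sharing only
terminals and a mark lying only in its two blocks (`IsNecklace`).  The pattern `nkOpen ω j` records
whether block `j` connects its terminals inside itself (`blockCfg`).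

* **`conn_marks_iff_nk`**: `q k ↔ q k'` under `ω` iff `k ↔ k'` in `C₅` under the pattern — the
  forward direction by the cut argument (`conn_nkOpen_of_conn`: the vertices of the open blocks of
  the `C₅`-cluster of `k` together with the within-block clusters of its terminals form a set
  closed under open adjacency, `mem_of_conn_of_closed`), the converse by chaining open blocks
  (`conn_of_conn_nkOpen`).

The law of the pattern and (HCOV) on every necklace follow in `CycleNecklace.lean`.
-/

namespace Summit.Ventures.PercRepro2

namespace Cycle

/-! ## Necklaces: five mark-free two-terminal blocks in a cycle -/

section Necklace

variable {V : Type*} {E : Type*} [Fintype E] [DecidableEq E]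

/-- **A necklace**: the edges are partitioned into five blocks (`blk e`), block `j` lives on the
vertex set `Vj j`, which contains its two terminals `q j` and `q (j + 1)` (the marks, in cyclic
order); two different blocks share only terminals, and a mark lies only in its two blocks. -/
structure IsNecklace (ends : E → Sym2 V) (q : Fin 5 → V) (blk : E → Fin 5) (Vj : Fin 5 → Set V) :
    Prop where
  /-- The ends of an edge lie in the vertex set of its block. -/
  ends_mem : ∀ e, ∀ x ∈ ends e, x ∈ Vj (blk e)
  /-- The terminals of block `j` lie in its vertex set. -/
  term_mem : ∀ j, q j ∈ Vj j ∧ q (j + 1) ∈ Vj j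
  /-- A vertex of two different blocks is a terminal of the first. -/
  inter_marks : ∀ j j', j ≠ j' → ∀ x, x ∈ Vj j → x ∈ Vj j' → x = q j ∨ x = q (j + 1)
  /-- A mark lies only in its two blocks. -/
  mark_mem : ∀ j m, q m ∈ Vj j → m = j ∨ m = j + 1
  /-- The marks are distinct. -/
  q_inj : Function.Injective q

/-- The block-`j` configuration: the edges of block `j` that are open in `ω`. -/
def blockCfg (blk : E → Fin 5) (j : Fin 5) (ω : Config E) : Config E :=
  fun e => ω e && decide (blk e = j)

omit [Fintype E] [DecidableEq E] in
/-- The block configuration is below the configuration. -/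
lemma blockCfg_le (blk : E → Fin 5) (j : Fin 5) (ω : Config E) : blockCfg blk j ω ≤ ω := by
  intro e
  simp only [blockCfg]
  cases ω e <;> simp

omit [Fintype E] [DecidableEq E] in
/-- An open edge of block `j` is open in the block configuration. -/
lemma blockCfg_apply_of_eq {blk : E → Fin 5} {j : Fin 5} {e : E} {ω : Config E} (he : ω e = true)
    (hj : blk e = j) : blockCfg blk j ω e = true := by
  simp [blockCfg, he, hj]

omit [Fintype E] [DecidableEq E] in
/-- An edge open in the block configuration is an open edge of the block. -/
lemma of_blockCfg_eq_true {blk : E → Fin 5} {j : Fin 5} {e : E} {ω : Config E}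
    (h : blockCfg blk j ω e = true) : ω e = true ∧ blk e = j := by
  simpa [blockCfg] using h

open scoped Classical in
/-- **The necklace pattern**: block `j` is open iff its two terminals are connected inside it. -/
noncomputable def nkOpen (ends : E → Sym2 V) (q : Fin 5 → V) (blk : E → Fin 5) (ω : Config E) :
    Config (Fin 5) :=
  fun j => decide (Conn ends (blockCfg blk j ω) (q j) (q (j + 1)))

omit [Fintype E] [DecidableEq E] in
/-- Block `j` is open iff its terminals are connected inside it. -/
lemma nkOpen_eq_true_iff (ends : E → Sym2 V) (q : Fin 5 → V) (blk : E → Fin 5) (ω : Config E)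
    (j : Fin 5) : nkOpen ends q blk ω j = true ↔ Conn ends (blockCfg blk j ω) (q j) (q (j + 1)) := by
  simp [nkOpen]

omit [Fintype E] [DecidableEq E] in
/-- Block `j` is closed iff its terminals are not connected inside it. -/
lemma nkOpen_eq_false_iff (ends : E → Sym2 V) (q : Fin 5 → V) (blk : E → Fin 5) (ω : Config E)
    (j : Fin 5) :
    nkOpen ends q blk ω j = false ↔ ¬ Conn ends (blockCfg blk j ω) (q j) (q (j + 1)) := by
  simp [nkOpen]

variable {ends : E → Sym2 V} {q : Fin 5 → V} {blk : E → Fin 5} {Vj : Fin 5 → Set V}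

omit [Fintype E] [DecidableEq E] in
/-- Inside block `j`, connectivity stays in the vertex set of the block. -/
lemma mem_Vj_of_conn_blockCfg (hN : IsNecklace ends q blk Vj) {j : Fin 5} {ω : Config E} {x y : V}
    (hx : x ∈ Vj j) (h : Conn ends (blockCfg blk j ω) x y) : y ∈ Vj j := by
  refine mem_of_conn_of_closed (S := Vj j) ?_ hx h
  intro u _ w huw
  rw [openGraph_adj] at huw
  obtain ⟨_, e, he, hends⟩ := huw
  obtain ⟨_, hj⟩ := of_blockCfg_eq_true he
  have := hN.ends_mem e w (by rw [hends]; exact Sym2.mem_mk_right u w)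
  rwa [hj] at this

omit [Fintype E] [DecidableEq E] in
/-- Connectivity inside a block is connectivity. -/
lemma conn_of_conn_blockCfg {j : Fin 5} {ω : Config E} {x y : V}
    (h : Conn ends (blockCfg blk j ω) x y) : Conn ends ω x y :=
  conn_mono (blockCfg_le blk j ω) h

omit [Fintype E] [DecidableEq E] in
/-- An open block connects its terminals. -/
lemma conn_terminals_of_nkOpen {ω : Config E} {j : Fin 5} (h : nkOpen ends q blk ω j = true) :
    Conn ends ω (q j) (q (j + 1)) :=
  conn_of_conn_blockCfg ((nkOpen_eq_true_iff ends q blk ω j).1 h)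

omit [Fintype E] [DecidableEq E] in
/-- **From the pattern to the necklace**: `k ↔ k'` in `C₅` under the pattern gives `q k ↔ q k'`. -/
lemma conn_of_conn_nkOpen {ω : Config E} {k k' : Fin 5}
    (h : Conn (cycN 5) (nkOpen ends q blk ω) k k') : Conn ends ω (q k) (q k') := by
  rw [Conn, SimpleGraph.reachable_iff_reflTransGen] at h
  induction h with
  | refl => exact conn_refl _ _ _
  | tail _ hxy ih =>
    rename_i x z
    refine conn_trans ih ?_
    rw [openGraph_adj] at hxy
    obtain ⟨_, j, hj, hends⟩ := hxy
    rw [cycN_apply, Sym2.eq_iff] at hends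
    rcases hends with ⟨rfl, rfl⟩ | ⟨rfl, rfl⟩
    · exact conn_terminals_of_nkOpen hj
    · exact conn_symm (conn_terminals_of_nkOpen hj)

omit [Fintype E] [DecidableEq E] in
/-- The `C₅`-cluster of a mark index is closed upward along open blocks. -/
lemma cluster_succ_of_nkOpen {σ : Config (Fin 5)} {k m : Fin 5} (hT : Conn (cycN 5) σ k m)
    (hσ : σ m = true) : Conn (cycN 5) σ k (m + 1) :=
  conn_trans hT (conn_of_openAdj ⟨m, hσ, rfl⟩)

omit [Fintype E] [DecidableEq E] in
/-- The `C₅`-cluster of a mark index is closed downward along open blocks. -/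
lemma cluster_pred_of_nkOpen {σ : Config (Fin 5)} {k m : Fin 5} (hT : Conn (cycN 5) σ k (m + 1))
    (hσ : σ m = true) : Conn (cycN 5) σ k m :=
  conn_trans hT (conn_symm (conn_of_openAdj ⟨m, hσ, rfl⟩))

omit [Fintype E] [DecidableEq E] in
/-- Two distinct terminals of a block connected inside it make the block open. -/
lemma nkOpen_of_conn_terminals {ω : Config E} {j m m' : Fin 5}
    (hm : m = j ∨ m = j + 1) (hm' : m' = j ∨ m' = j + 1) (hne : m ≠ m')
    (h : Conn ends (blockCfg blk j ω) (q m) (q m')) : nkOpen ends q blk ω j = true := by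
  rw [nkOpen_eq_true_iff]
  rcases hm with rfl | rfl <;> rcases hm' with rfl | rfl
  · exact absurd rfl hne
  · exact h
  · exact conn_symm h
  · exact absurd rfl hne

omit [Fintype E] [DecidableEq E] in
/-- A mark of a block is one of its two terminals, as an index. -/
lemma index_of_mark_mem (hN : IsNecklace ends q blk Vj) {j m : Fin 5} (h : q m ∈ Vj j) :
    m = j ∨ m = j + 1 :=
  hN.mark_mem j m h

omit [Fintype E] [DecidableEq E] in
/-- A vertex of two different blocks is a mark, and a terminal of both blocks. -/
lemma exists_mark_of_mem_two (hN : IsNecklace ends q blk Vj) {j j' : Fin 5} (hjj : j ≠ j') {x : V}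
    (hx : x ∈ Vj j) (hx' : x ∈ Vj j') :
    ∃ m, x = q m ∧ (m = j ∨ m = j + 1) ∧ (m = j' ∨ m = j' + 1) := by
  rcases hN.inter_marks j j' hjj x hx hx' with h | h
  · refine ⟨j, h, Or.inl rfl, ?_⟩
    exact hN.mark_mem j' j (h ▸ hx')
  · refine ⟨j + 1, h, Or.inr rfl, ?_⟩
    exact hN.mark_mem j' (j + 1) (h ▸ hx')

omit [Fintype E] [DecidableEq E] in
/-- **From the necklace to the pattern**: `q k ↔ q k'` gives `k ↔ k'` in `C₅` under the pattern
(the cut argument: the vertices of the open blocks of the `C₅`-cluster of `k` together with the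
within-block clusters of its terminals form a set closed under open adjacency). -/
lemma conn_nkOpen_of_conn (hN : IsNecklace ends q blk Vj) {ω : Config E} {k k' : Fin 5}
    (h : Conn ends ω (q k) (q k')) : Conn (cycN 5) (nkOpen ends q blk ω) k k' := by
  set σ := nkOpen ends q blk ω with hσdef
  -- the closed set
  set S : Set V := {v | ∃ j, σ j = true ∧ Conn (cycN 5) σ k j ∧ v ∈ Vj j} ∪
    {v | ∃ j, σ j = false ∧ ∃ m, Conn (cycN 5) σ k m ∧ (m = j ∨ m = j + 1) ∧
      Conn ends (blockCfg blk j ω) (q m) v} with hS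
  -- membership helpers
  have mem_first : ∀ {v j}, σ j = true → Conn (cycN 5) σ k j → v ∈ Vj j → v ∈ S :=
    fun hj hT hv => Or.inl ⟨_, hj, hT, hv⟩
  have mem_second : ∀ {v j m}, σ j = false → Conn (cycN 5) σ k m → (m = j ∨ m = j + 1) →
      Conn ends (blockCfg blk j ω) (q m) v → v ∈ S :=
    fun hj hT hm hc => Or.inr ⟨_, hj, _, hT, hm, hc⟩
  -- a terminal index of a block `j` in the cluster, with `j` open, gives `j` in the cluster
  have cluster_of_terminal : ∀ {j m}, σ j = true → Conn (cycN 5) σ k m → (m = j ∨ m = j + 1) →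
      Conn (cycN 5) σ k j := by
    intro j m hj hT hm
    rcases hm with rfl | rfl
    · exact hT
    · exact cluster_pred_of_nkOpen hT hj
  -- a mark `q m` of a block `j` with `m` in the cluster: the next step through an edge of `j`
  have step : ∀ {j m y}, Conn (cycN 5) σ k m → (m = j ∨ m = j + 1) →
      Conn ends (blockCfg blk j ω) (q m) y → y ∈ S := by
    intro j m y hT hm hc
    cases hj : σ j
    · exact mem_second hj hT hm hc
    · exact mem_first hj (cluster_of_terminal hj hT hm)
        (mem_Vj_of_conn_blockCfg hN (by rcases hm with rfl | rfl; exacts [(hN.term_mem _).1,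
          (hN.term_mem _).2]) hc)
  -- `S` is closed under open adjacency
  have hclosed : ∀ x ∈ S, ∀ y, (openGraph ends ω).Adj x y → y ∈ S := by
    intro x hx y hxy
    rw [openGraph_adj] at hxy
    obtain ⟨_, e, he, hends⟩ := hxy
    have hxj : x ∈ Vj (blk e) := hN.ends_mem e x (by rw [hends]; exact Sym2.mem_mk_left x y)
    have hyj : y ∈ Vj (blk e) := hN.ends_mem e y (by rw [hends]; exact Sym2.mem_mk_right x y)
    have hxy_j : Conn ends (blockCfg blk (blk e) ω) x y :=
      conn_of_openAdj ⟨e, blockCfg_apply_of_eq he rfl, hends⟩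
    rcases hx with ⟨j₀, hj₀, hT₀, hx₀⟩ | ⟨j₀, hj₀, m, hTm, hm, hc⟩
    · -- `x` in an open block of the cluster
      by_cases hjj : j₀ = blk e
      · subst hjj
        exact mem_first hj₀ hT₀ hyj
      · obtain ⟨m, hxm, hm₀, hmj⟩ := exists_mark_of_mem_two hN hjj hx₀ hxj
        have hTm : Conn (cycN 5) σ k m := by
          rcases hm₀ with rfl | rfl
          · exact hT₀
          · exact cluster_succ_of_nkOpen hT₀ hj₀
        exact step hTm hmj (hxm ▸ hxy_j)
    · -- `x` in the within-block cluster of a terminal of a closed block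
      by_cases hjj : j₀ = blk e
      · subst hjj
        exact mem_second hj₀ hTm hm (conn_trans hc hxy_j)
      · have hxj₀ : x ∈ Vj j₀ :=
          mem_Vj_of_conn_blockCfg hN (by rcases hm with rfl | rfl; exacts [(hN.term_mem _).1,
            (hN.term_mem _).2]) hc
        obtain ⟨m', hxm', hm'₀, hm'j⟩ := exists_mark_of_mem_two hN hjj hxj₀ hxj
        -- `m'` is in the cluster: either `m' = m`, or the two terminals of `j₀` are connected
        have hTm' : Conn (cycN 5) σ k m' := by
          by_cases hmm : m = m'
          · exact hmm ▸ hTm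
          · exfalso
            have : σ j₀ = true :=
              nkOpen_of_conn_terminals hm hm'₀ hmm (hxm' ▸ hc)
            rw [hj₀] at this
            exact Bool.false_ne_true this
        exact step hTm' hm'j (hxm' ▸ hxy_j)
  -- `q k ∈ S`
  have hk : q k ∈ S := by
    cases hj : σ k
    · exact mem_second hj (conn_refl _ _ _) (Or.inl rfl) (conn_refl _ _ _)
    · exact mem_first hj (conn_refl _ _ _) (hN.term_mem k).1
  -- `q k' ∈ S` forces `k'` into the cluster
  have hk' : q k' ∈ S := mem_of_conn_of_closed hclosed hk h
  rcases hk' with ⟨j₀, hj₀, hT₀, hx₀⟩ | ⟨j₀, hj₀, m, hTm, hm, hc⟩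
  · rcases index_of_mark_mem hN hx₀ with rfl | rfl
    · exact hT₀
    · exact cluster_succ_of_nkOpen hT₀ hj₀
  · have hx₀ : q k' ∈ Vj j₀ :=
      mem_Vj_of_conn_blockCfg hN (by rcases hm with rfl | rfl; exacts [(hN.term_mem _).1,
        (hN.term_mem _).2]) hc
    have hk'₀ := index_of_mark_mem hN hx₀
    by_cases hmk : m = k'
    · exact hmk ▸ hTm
    · exfalso
      have : σ j₀ = true := nkOpen_of_conn_terminals hm hk'₀ hmk hc
      rw [hj₀] at this
      exact Bool.false_ne_true this

omit [Fintype E] [DecidableEq E] in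
/-- **Connectivity between the marks of a necklace is connectivity of its pattern on `C₅`.** -/
theorem conn_marks_iff_nk (hN : IsNecklace ends q blk Vj) (ω : Config E) (k k' : Fin 5) :
    Conn ends ω (q k) (q k') ↔ Conn (cycN 5) (nkOpen ends q blk ω) k k' :=
  ⟨conn_nkOpen_of_conn hN, conn_of_conn_nkOpen⟩


end Necklace

end Cycle

end Summit.Ventures.PercRepro2
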